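import Literature.AnabelianGeometry.EtaleTheta.RealificationIsoWeak
import Literature.AnabelianGeometry.EtaleTheta.RealifiedDivisorMonoidsOfRlfWeak
import Literature.AnabelianGeometry.EtaleTheta.TemperedFrobenioidModel
import Literature.AlgebraicGeometry.Frobenioids.ModelFrobenioidBaseChangeEquivalence
import HarnessLib

/-!
# [EtTh] Def. 3.6 (ii) / [FrdI] Cor. 5.4: an ISOMORPHISM of Def. 3.3 (iii) data along the base functors of two tempered
# Frobenioids of monoid type `ℤ` (weak Def. 3.6 (i) data, `Φ := im(Φ₀^pf → Φ₀^rlf)`) induces an EQUIVALENCE `C₁ ≌ C₂` over `𝟭 D`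

S. Mochizuki, *The étale theta function …*, Publ. RIMS **45** (2009) [MochizukiEtTh2009], Def. 3.3 (iii) p.73, Def. 3.6 (i)(ii)
p.76–77 («the data `(D, Φ, B, B → Φ^gp)` determines a model Frobenioid») [cite: MochizukiEtTh2009, Def 3.6 p.77];
S. Mochizuki, *The geometry of Frobenioids I*, Kyushu J. Math. **62** (2008) [MochizukiFrdI2008], Thm. 5.2 (i) p.100, Prop. 5.3
p.103 (`Φ^rlf` is functorial), Cor. 5.4 p.104 («the horizontal arrows are equivalences of categories»).

abc-iut cell, layer L2 [EtTh], seat abc-iut-w5-d179 (gen 7), L2-lead row R751/R761 «NONID-PSI-3» (piece 3 of the non-identity-`Ψ`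
route; pieces 1–2 = p473513 `LogDivisorModelTateTowerReflection`, p473903 `RealificationIsoWeak`), FILE 1 of 2 = the GENERIC ENGINE.
Given two tempered Frobenioids `C₁`, `C₂` (Def. 3.6 (ii)) over the SAME base category `D`, of monoid type `ℤ` over the weak
Def. 3.6 (i) data `ofRlfZWeak dm₁ hpf₁`, `ofRlfZWeak dm₂ hpf₂` (abc-iut-L6-t12), whose divisor monoids are print's
`Φ(A) = im(Φ₀(Y_A)^pf → Φ₀(Y_A)^rlf)` (fields `hΦ₁`, `hΦ₂`), and an ISOMORPHISM of the Def. 3.3 (iii) data along the two base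
functors — `TemperedFrobenioid.PfIsoData`: `e_A : Φ₀₁(Y_A) ≅ Φ₀₂(Y'_A)`, `b_A : B₀₁(Y_A) ≅ B₀₂(Y'_A)` natural in `A` with
`div₀₂ ∘ b_A = e_A^gp ∘ div₀₁` — this file constructs:
* `PfIsoData.rlfEquiv A : Φ₀₁(Y_A)^rlf ≅ Φ₀₂(Y'_A)^rlf` (this lineage's `RlfIsoWeak.equiv`), `toRlf_e` (it lies over `Φ₀ → Φ₀^rlf`),
  `rlfEquiv_rlfMapWeak` (it commutes with the pull-backs `Φ₀(f)^rlf` — by the UNIQUENESS half of abc-iut-L2-d2's weak universal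
  property, `RlfIsoWeak.map_comp_map`), `divΛ_b` (`B₀^Λ → (Φ₀^ℝ)^gp` is intertwined);
* **`PfIsoData.ηHom A : Φ₁(A) → Φ₂(A)`** (restriction of `rlfEquiv` to the `Φ₀^pf`-images; natural `ηHom_pull`; BIJECTIVE
  `ηHom_bijective` by `RlfIsoWeak.mem_mrange_iff`) and **`PfIsoData.βHom A : B₁(A) → B₂(A)`** on the FIBRE PRODUCTS
  `B = B₀^Λ|_D ×_{(Φ^rlog)^gp} Φ^gp` (`(b, ξ) ↦ (b_A b, η^gp ξ)`; the fibre condition by `divΛ_b` + `ΦgpToRlog_ηgp`; natural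
  `βHom_pull`; BIJECTIVE `βHom_bijective` — surjective because `rlfEquiv^gp` is injective);
* **`PfIsoData.dataHom : ModelFrobenioid.DataHomOver (𝟭 D) Div_{B₁} Div_{B₂}`** (abc-iut-w5-d048) and, by abc-iut-w5-d137's criterion
  `DataHomOver.functor_isEquivalence` ([FrdI] Cor. 5.4), **`PfIsoData.equivalence : C₁.category ≌ C₂.category`** lying over `𝟭 D`
  ON THE NOSE (`functor_comp_baseFunctor`), with `(A, α) ↦ (A, η^gp α)` (`equivalence_functor_obj`) and `η (ι a) = ι (e^pf a)`
  (`coe_ηHom_toRealification`).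
Class (b): 1 structure (`PfIsoData`) + 7 defs (`rlfEquiv`, `rlfEquivGp`, `ηHom`, `βHom`, `η`, `β`, `dataHom`, `equivalence`);
no Prop-valued fact, no instance, no notation, no sorry.  FILE 2 (`BiKummerThm44HypOfGaloisCoveringZTowerReflect`) instantiates
it at the ℤ-tower reflection `n ↦ −n`.  HONEST FRAMING: plumbing inside [FrdI] Thm. 5.2 / Cor. 5.4 over interface records;
nothing here bears on [IUTchIII] Cor. 3.12; typed ≠ proved.
-/

noncomputable section

namespace Literature.AnabelianGeometry.EtaleTheta

open CategoryTheory Opposite Function Literature.AlgebraicGeometry.Frobenioids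

universe u₀ v₀ u₀' v₀' u v w

/-- `Φ₀(f)^rlf` of the weak realification functor IS `RlfIsoWeak.map` of `Φ₀(f)` (same universal arrow).
[cite: MochizukiFrdI2008, Prop. 5.3 p.103] -/
theorem rlfMapWeak_eq_rlfIsoWeakMap {D₀ : Type u₀} [Category.{v₀} D₀] (dm : DivisorMonoids.{u₀, v₀, w} D₀)
    (hpf : ∀ Y : D₀ᵒᵖ, IsPerfFactorialCof (dm.Φ₀.obj Y)) {Y Y' : D₀ᵒᵖ} (f : Y ⟶ Y') :
    rlfMapWeak dm.Φ₀ hpf f = RlfIsoWeak.map (hpf Y) (hpf Y') (dm.Φ₀.map f).hom := rfl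

namespace TemperedFrobenioid

variable {D₀ : Type u₀} [Category.{v₀} D₀] {D₀' : Type u₀'} [Category.{v₀'} D₀']
  {dm₁ : DivisorMonoids.{u₀, v₀, w} D₀} {dm₂ : DivisorMonoids.{u₀', v₀', w} D₀'}
  {hpf₁ : ∀ Y : D₀ᵒᵖ, IsPerfFactorialCof (dm₁.Φ₀.obj Y)} {hpf₂ : ∀ Y : D₀'ᵒᵖ, IsPerfFactorialCof (dm₂.Φ₀.obj Y)}
  {D : Type u} [Category.{v} D] {VD₁ VD₂ : FrdICatStub.{u, v, w} D}

variable (hpf₁ hpf₂) in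
/-- **An isomorphism of Def. 3.3 (iii) data along the base functors of two tempered Frobenioids over the same base `D`**
(monoid type `ℤ`, weak Def. 3.6 (i) data, `Φ = im(Φ₀^pf → Φ₀^rlf)`): `e_A : Φ₀₁(Y_A) ≅ Φ₀₂(Y'_A)` and `b_A : B₀₁(Y_A) ≅ B₀₂(Y'_A)`
natural in `A ∈ Ob(D)` and compatible with `div₀ : B₀ → Φ₀^gp`. [cite: MochizukiEtTh2009, Def 3.3 p.73] -/
structure PfIsoData (C₁ : TemperedFrobenioid (RealifiedDivisorMonoids.ofRlfZWeak dm₁ hpf₁) D VD₁)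
    (C₂ : TemperedFrobenioid (RealifiedDivisorMonoids.ofRlfZWeak dm₂ hpf₂) D VD₂) : Type (max u v w) where
  /-- `e_A : Φ₀₁(Y_A) ≅ Φ₀₂(Y'_A)` -/
  e : ∀ A : Dᵒᵖ, (dm₁.Φ₀.obj (C₁.baseOp A) : Type w) ≃* dm₂.Φ₀.obj (C₂.baseOp A)
  /-- naturality of `e` along the pull-backs of `Φ₀` -/
  e_natural : ∀ {A A' : Dᵒᵖ} (g : A ⟶ A') (m : dm₁.Φ₀.obj (C₁.baseOp A)),
    e A' ((dm₁.Φ₀.map (C₁.base.map g.unop).op).hom m) = (dm₂.Φ₀.map (C₂.base.map g.unop).op).hom (e A m)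
  /-- `b_A : B₀₁(Y_A) ≅ B₀₂(Y'_A)` -/
  b : ∀ A : Dᵒᵖ, (dm₁.B₀.obj (C₁.baseOp A) : Type w) ≃* dm₂.B₀.obj (C₂.baseOp A)
  /-- naturality of `b` along the pull-backs of `B₀` -/
  b_natural : ∀ {A A' : Dᵒᵖ} (g : A ⟶ A') (x : dm₁.B₀.obj (C₁.baseOp A)),
    b A' ((dm₁.B₀.map (C₁.base.map g.unop).op).hom x) = (dm₂.B₀.map (C₂.base.map g.unop).op).hom (b A x)
  /-- compatibility with the log-divisor of zeroes and poles: `div₀₂ (b x) = e^gp (div₀₁ x)` -/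
  div₀_b : ∀ (A : Dᵒᵖ) (x : dm₁.B₀.obj (C₁.baseOp A)),
    dm₂.div₀ (C₂.baseOp A) (b A x) = gpMap (e A).toMonoidHom (dm₁.div₀ (C₁.baseOp A) x)
  /-- `Φ₁(A) = im(Φ₀₁(Y_A)^pf → Φ₀₁(Y_A)^rlf)` -/
  hΦ₁ : ∀ A : Dᵒᵖ, C₁.Φ.carrier A = MonoidHom.mrange (hpf₁ (C₁.baseOp A)).weak.toRealification
  /-- `Φ₂(A) = im(Φ₀₂(Y'_A)^pf → Φ₀₂(Y'_A)^rlf)` -/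
  hΦ₂ : ∀ A : Dᵒᵖ, C₂.Φ.carrier A = MonoidHom.mrange (hpf₂ (C₂.baseOp A)).weak.toRealification

namespace PfIsoData

variable {C₁ : TemperedFrobenioid (RealifiedDivisorMonoids.ofRlfZWeak dm₁ hpf₁) D VD₁}
  {C₂ : TemperedFrobenioid (RealifiedDivisorMonoids.ofRlfZWeak dm₂ hpf₂) D VD₂} (I : PfIsoData hpf₁ hpf₂ C₁ C₂)

/-! ### The realified component `Φ₀₁(Y_A)^rlf ≅ Φ₀₂(Y'_A)^rlf` -/

/-- **`e_A^rlf : Φ₀₁(Y_A)^rlf ≅ Φ₀₂(Y'_A)^rlf`** (this lineage's `RlfIsoWeak.equiv`). [cite: MochizukiFrdI2008, Prop. 5.3 p.103] -/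
def rlfEquiv (A : Dᵒᵖ) : (hpf₁ (C₁.baseOp A)).weak.Rlf ≃* (hpf₂ (C₂.baseOp A)).weak.Rlf :=
  RlfIsoWeak.equiv (hpf₁ (C₁.baseOp A)) (hpf₂ (C₂.baseOp A)) (I.e A)

/-- `e_A^rlf` lies over `e_A^pf`. [cite: MochizukiFrdI2008, Prop. 5.3 p.103] -/
theorem rlfEquiv_toRealification (A : Dᵒᵖ) (a : Literature.AlgebraicGeometry.Frobenioids.Perfection (dm₁.Φ₀.obj (C₁.baseOp A))) :
    I.rlfEquiv A ((hpf₁ (C₁.baseOp A)).weak.toRealification a) =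
      (hpf₂ (C₂.baseOp A)).weak.toRealification (Literature.AlgebraicGeometry.Frobenioids.Perfection.map (I.e A).toMonoidHom a) :=
  RlfIsoWeak.equiv_toRealification _ _ _ a

/-- `e_A^rlf` lies over `e_A` through `Φ₀ → Φ₀^pf → Φ₀^rlf`. [cite: MochizukiEtTh2009, Def 3.6 p.76] -/
theorem toRlf_e (A : Dᵒᵖ) (m : dm₁.Φ₀.obj (C₁.baseOp A)) :
    ((toRlfNatTransWeak dm₂.Φ₀ hpf₂).app (C₂.baseOp A)).hom (I.e A m) =
      I.rlfEquiv A (((toRlfNatTransWeak dm₁.Φ₀ hpf₁).app (C₁.baseOp A)).hom m) := by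
  change (hpf₂ (C₂.baseOp A)).weak.toRealification (Literature.AlgebraicGeometry.Frobenioids.Perfection.of _ (I.e A m)) =
    I.rlfEquiv A ((hpf₁ (C₁.baseOp A)).weak.toRealification (Literature.AlgebraicGeometry.Frobenioids.Perfection.of _ m))
  rw [rlfEquiv_toRealification]
  rfl

/-- **`e^rlf` commutes with the pull-backs `Φ₀(f)^rlf`** (uniqueness of the universal arrows: both composites lie over
`e ∘ Φ₀₁(f) = Φ₀₂(f) ∘ e`). [cite: MochizukiFrdI2008, Prop. 5.3 p.103] -/
theorem rlfEquiv_rlfMapWeak {A A' : Dᵒᵖ} (g : A ⟶ A') (y : (hpf₁ (C₁.baseOp A)).weak.Rlf) :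
    I.rlfEquiv A' (rlfMapWeak dm₁.Φ₀ hpf₁ (C₁.base.map g.unop).op y) =
      rlfMapWeak dm₂.Φ₀ hpf₂ (C₂.base.map g.unop).op (I.rlfEquiv A y) := by
  rw [rlfEquiv, rlfEquiv, RlfIsoWeak.equiv_apply, RlfIsoWeak.equiv_apply, rlfMapWeak_eq_rlfIsoWeakMap,
    rlfMapWeak_eq_rlfIsoWeakMap, ← MonoidHom.comp_apply, ← RlfIsoWeak.map_comp_map, ← MonoidHom.comp_apply,
    ← RlfIsoWeak.map_comp_map (hpf₁ (C₁.baseOp A)) (hpf₂ (C₂.baseOp A)) (hpf₂ (C₂.baseOp A')),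
    show (I.e A').toMonoidHom.comp (dm₁.Φ₀.map (C₁.base.map g.unop).op).hom =
      (dm₂.Φ₀.map (C₂.base.map g.unop).op).hom.comp (I.e A).toMonoidHom from MonoidHom.ext fun m => I.e_natural g m]

/-- `(e_A^rlf)^gp` on the groupifications. [cite: MochizukiFrdI2008, Prop. 5.3 p.103] -/
abbrev rlfEquivGp (A : Dᵒᵖ) :
    Algebra.GrothendieckGroup (hpf₁ (C₁.baseOp A)).weak.Rlf →* Algebra.GrothendieckGroup (hpf₂ (C₂.baseOp A)).weak.Rlf :=
  gpMap (I.rlfEquiv A).toMonoidHom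

/-- `(e_A^rlf)^gp` is bijective. [cite: MochizukiFrdI2008, Def. 1.1 (ii) p.19] -/
theorem rlfEquivGp_bijective (A : Dᵒᵖ) : Bijective (I.rlfEquivGp A) :=
  gpMap_bijective_of_bijective _ (I.rlfEquiv A).bijective

/-- `(Φ₀ → Φ₀^rlf)^gp` is intertwined: `ι₂^gp ∘ e^gp = (e^rlf)^gp ∘ ι₁^gp`. [cite: MochizukiEtTh2009, Def 3.6 p.76] -/
theorem gpMap_toRlf_gpMap_e (A : Dᵒᵖ) (ξ : Algebra.GrothendieckGroup (dm₁.Φ₀.obj (C₁.baseOp A))) :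
    gpMap ((toRlfNatTransWeak dm₂.Φ₀ hpf₂).app (C₂.baseOp A)).hom (gpMap (I.e A).toMonoidHom ξ) =
      I.rlfEquivGp A (gpMap ((toRlfNatTransWeak dm₁.Φ₀ hpf₁).app (C₁.baseOp A)).hom ξ) := by
  have key : (gpMap ((toRlfNatTransWeak dm₂.Φ₀ hpf₂).app (C₂.baseOp A)).hom).comp (gpMap (I.e A).toMonoidHom) =
      (I.rlfEquivGp A).comp (gpMap ((toRlfNatTransWeak dm₁.Φ₀ hpf₁).app (C₁.baseOp A)).hom) :=
    MonGp.hom_ext fun m => by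
      change gpMap ((toRlfNatTransWeak dm₂.Φ₀ hpf₂).app (C₂.baseOp A)).hom
          (gpMap (I.e A).toMonoidHom (Algebra.GrothendieckGroup.of m)) =
        gpMap (I.rlfEquiv A).toMonoidHom
          (gpMap ((toRlfNatTransWeak dm₁.Φ₀ hpf₁).app (C₁.baseOp A)).hom (Algebra.GrothendieckGroup.of m))
      rw [gpMap_of, gpMap_of, gpMap_of]
      exact (congrArg Algebra.GrothendieckGroup.of (I.toRlf_e A m)).trans (gpMap_of _ _).symm
  exact DFunLike.congr_fun key ξ

/-- **`B₀^Λ → (Φ₀^ℝ)^gp` is intertwined**: `divΛ₂ (b x) = (e^rlf)^gp (divΛ₁ x)` (`Λ = ℤ`: `divΛ = ι^gp ∘ div₀`).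
[cite: MochizukiEtTh2009, Def 3.6 p.76] -/
theorem divΛ_b (A : Dᵒᵖ) (x : dm₁.B₀.obj (C₁.baseOp A)) :
    (RealifiedDivisorMonoids.ofRlfZWeak dm₂ hpf₂).divΛ (C₂.baseOp A) (I.b A x) =
      I.rlfEquivGp A ((RealifiedDivisorMonoids.ofRlfZWeak dm₁ hpf₁).divΛ (C₁.baseOp A) x) := by
  rw [RealifiedDivisorMonoids.ofRlfZWeak_divΛ_apply, RealifiedDivisorMonoids.ofRlfZWeak_divΛ_apply, I.div₀_b,
    gpMap_toRlf_gpMap_e]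

/-! ### `η : Φ₁ → Φ₂` on the divisor monoids -/

/-- **`η_A : Φ₁(A) → Φ₂(A)`** — `e_A^rlf` restricted to the images of the perfections (`RlfIsoWeak.mem_mrange_iff`).
[cite: MochizukiEtTh2009, Def 3.6 p.77] -/
def ηHom (A : Dᵒᵖ) : C₁.Φ.carrier A →* C₂.Φ.carrier A :=
  ((I.rlfEquiv A).toMonoidHom.comp (C₁.Φ.carrier A).subtype).codRestrict (C₂.Φ.carrier A) fun x =>
    (I.hΦ₂ A).ge ((RlfIsoWeak.mem_mrange_iff (hpf₁ (C₁.baseOp A)) (hpf₂ (C₂.baseOp A)) (I.e A) x.1).2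
      ((I.hΦ₁ A).le x.2))

/-- `η_A` on elements is `e_A^rlf`. [cite: MochizukiEtTh2009, Def 3.6 p.77] -/
@[simp] theorem coe_ηHom (A : Dᵒᵖ) (x : C₁.Φ.carrier A) : (I.ηHom A x).1 = I.rlfEquiv A x.1 := rfl

/-- **`η_A (ι a) = ι (e_A^pf a)`**: on the image of `Φ₀₁(Y_A)^pf`, `η` IS `e` (what the induced functor does to divisors).
[cite: MochizukiEtTh2009, Def 3.6 p.77] -/
theorem coe_ηHom_toRealification (A : Dᵒᵖ) (a : Literature.AlgebraicGeometry.Frobenioids.Perfection (dm₁.Φ₀.obj (C₁.baseOp A)))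
    (ha : (hpf₁ (C₁.baseOp A)).weak.toRealification a ∈ C₁.Φ.carrier A) :
    (I.ηHom A ⟨_, ha⟩).1 = (hpf₂ (C₂.baseOp A)).weak.toRealification (Literature.AlgebraicGeometry.Frobenioids.Perfection.map (I.e A).toMonoidHom a) :=
  I.rlfEquiv_toRealification A a

/-- **`η` is natural**: it commutes with the pull-backs `Φ_i(f) = Φ₀(Base f)^rlf|_{Φ_i}`. [cite: MochizukiEtTh2009, Def 3.6 p.77] -/
theorem ηHom_pull {A A' : Dᵒᵖ} (g : A ⟶ A') (x : C₁.Φ.carrier A) :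
    I.ηHom A' (C₁.Φ.pull g x) = C₂.Φ.pull g (I.ηHom A x) := by
  apply Subtype.ext
  rw [coe_ηHom, SubMonoidOn.coe_pull, SubMonoidOn.coe_pull, coe_ηHom]
  exact I.rlfEquiv_rlfMapWeak g x.1

/-- **`η_A` is bijective** (`e_A^rlf` carries `im Φ₀₁^pf` onto `im Φ₀₂^pf`). [cite: MochizukiFrdI2008, Cor. 5.4 p.104] -/
theorem ηHom_bijective (A : Dᵒᵖ) : Bijective (I.ηHom A) := by
  refine ⟨fun x y h => Subtype.ext ((I.rlfEquiv A).injective (congrArg Subtype.val h)), fun y => ?_⟩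
  have hy : (I.rlfEquiv A).symm y.1 ∈ C₁.Φ.carrier A := by
    refine (I.hΦ₁ A).ge ((RlfIsoWeak.mem_mrange_iff (hpf₁ (C₁.baseOp A)) (hpf₂ (C₂.baseOp A)) (I.e A) _).1 ?_)
    rw [show RlfIsoWeak.equiv _ _ (I.e A) ((I.rlfEquiv A).symm y.1) = y.1 from (I.rlfEquiv A).apply_symm_apply y.1]
    exact (I.hΦ₂ A).le y.2
  exact ⟨⟨_, hy⟩, Subtype.ext ((I.rlfEquiv A).apply_symm_apply y.1)⟩

/-- `Φ^gp → (Φ^rlog)^gp` is intertwined: `ι₂^gp (η^gp ξ) = (e^rlf)^gp (ι₁^gp ξ)`. [cite: MochizukiEtTh2009, Def 3.6 p.77] -/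
theorem ΦgpToRlog_ηgp (A : Dᵒᵖ) (ξ : Algebra.GrothendieckGroup (C₁.Φ.carrier A)) :
    C₂.ΦgpToRlog A (gpMap (I.ηHom A) ξ) = I.rlfEquivGp A (C₁.ΦgpToRlog A ξ) := by
  have key : (C₂.ΦgpToRlog A).comp (gpMap (I.ηHom A)) = (I.rlfEquivGp A).comp (C₁.ΦgpToRlog A) :=
    MonGp.hom_ext fun x => by
      change gpMap (C₂.Φ.carrier A).subtype (gpMap (I.ηHom A) (Algebra.GrothendieckGroup.of x)) =
        gpMap (I.rlfEquiv A).toMonoidHom (gpMap (C₁.Φ.carrier A).subtype (Algebra.GrothendieckGroup.of x))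
      rw [gpMap_of, gpMap_of, gpMap_of]
      exact (gpMap_of (I.rlfEquiv A).toMonoidHom x.1).symm
  exact DFunLike.congr_fun key ξ

/-! ### `β : B₁ → B₂` on the rational-function monoids (the fibre products) -/

/-- **`β_A : B₁(A) → B₂(A)`**, `(b, ξ) ↦ (b_A b, η_A^gp ξ)` on `B = B₀^Λ|_D ×_{(Φ^rlog)^gp} Φ^gp` — the fibre condition is carried over
because both structure maps are intertwined by `(e^rlf)^gp` (`divΛ_b`, `ΦgpToRlog_ηgp`). [cite: MochizukiEtTh2009, Def 3.6 p.77] -/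
def βHom (A : Dᵒᵖ) : C₁.ratFn A →* C₂.ratFn A :=
  (((I.b A).toMonoidHom.prodMap (gpMap (I.ηHom A))).comp (C₁.ratFn A).subtype).codRestrict (C₂.ratFn A) fun p => by
    change (RealifiedDivisorMonoids.ofRlfZWeak dm₂ hpf₂).divΛ (C₂.baseOp A) (I.b A p.1.1) =
      C₂.ΦgpToRlog A (gpMap (I.ηHom A) p.1.2)
    rw [I.divΛ_b, I.ΦgpToRlog_ηgp]
    exact congrArg (I.rlfEquivGp A) p.2

/-- Components of `β_A`. [cite: MochizukiEtTh2009, Def 3.6 p.77] -/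
@[simp] theorem coe_βHom (A : Dᵒᵖ) (p : C₁.ratFn A) : (I.βHom A p).1 = (I.b A p.1.1, gpMap (I.ηHom A) p.1.2) := rfl

/-- **`β` is natural**: it commutes with the componentwise pull-backs of `B`. [cite: MochizukiEtTh2009, Def 3.6 p.77] -/
theorem βHom_pull {A A' : Dᵒᵖ} (g : A ⟶ A') (p : C₁.ratFn A) :
    I.βHom A' (C₁.ratFnPull g p) = C₂.ratFnPull g (I.βHom A p) := by
  apply Subtype.ext
  rw [coe_βHom, coe_ratFnPull, coe_ratFnPull, coe_βHom]
  refine Prod.ext (I.b_natural g p.1.1) ?_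
  change gpMap (I.ηHom A') (gpMap (C₁.Φ.pull g) p.1.2) = gpMap (C₂.Φ.pull g) (gpMap (I.ηHom A) p.1.2)
  rw [← gpMap_comp_apply'', ← gpMap_comp_apply'',
    show (I.ηHom A').comp (C₁.Φ.pull g) = (C₂.Φ.pull g).comp (I.ηHom A) from MonoidHom.ext fun x => I.ηHom_pull g x]

/-- **`β_A` is bijective** (injective componentwise; a pair `(b⁻¹ y, (η^gp)⁻¹ ζ)` lies in the fibre product because `(e^rlf)^gp`
is injective). [cite: MochizukiFrdI2008, Cor. 5.4 p.104] -/
theorem βHom_bijective (A : Dᵒᵖ) : Bijective (I.βHom A) := by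
  have hη : Bijective (gpMap (I.ηHom A)) := gpMap_bijective_of_bijective _ (I.ηHom_bijective A)
  refine ⟨fun p q h => ?_, fun q => ?_⟩
  · have h1 := congrArg Subtype.val h
    rw [coe_βHom, coe_βHom] at h1
    obtain ⟨h1a, h1b⟩ := Prod.mk.inj h1
    exact Subtype.ext (Prod.ext ((I.b A).injective h1a) (hη.1 h1b))
  · obtain ⟨ξ, hξ⟩ := hη.2 q.1.2
    have hmem : ((I.b A).symm q.1.1, ξ) ∈ C₁.ratFn A := by
      change (RealifiedDivisorMonoids.ofRlfZWeak dm₁ hpf₁).divΛ (C₁.baseOp A) ((I.b A).symm q.1.1) = C₁.ΦgpToRlog A ξ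
      apply (I.rlfEquivGp_bijective A).1
      rw [← I.divΛ_b, ← I.ΦgpToRlog_ηgp, hξ, MulEquiv.apply_symm_apply]
      exact q.2
    exact ⟨⟨_, hmem⟩, Subtype.ext (Prod.ext ((I.b A).apply_symm_apply q.1.1) hξ)⟩

/-! ### The morphism of model data over `𝟭 D` and the induced equivalence `C₁ ≌ C₂` -/

/-- **`η : Φ₁ ⟶ Φ₂|_{𝟭 D}`** as a homomorphism of monoids on `D`. [cite: MochizukiFrdI2008, Prop. 5.3 p.103] -/
def η : C₁.divisorMonoid ⟶ (𝟭 D).op ⋙ C₂.divisorMonoid where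
  app A := CommMonCat.ofHom (I.ηHom A)
  naturality _ _ g := CommMonCat.hom_ext (MonoidHom.ext fun x => I.ηHom_pull g x)

/-- **`β : B₁ ⟶ B₂|_{𝟭 D}`** as a homomorphism of monoids on `D`. [cite: MochizukiFrdI2008, Prop. 5.3 p.103] -/
def β : C₁.ratFnFunctor ⟶ (𝟭 D).op ⋙ C₂.ratFnFunctor where
  app A := CommMonCat.ofHom (I.βHom A)
  naturality _ _ g := CommMonCat.hom_ext (MonoidHom.ext fun p => I.βHom_pull g p)

/-- **The morphism of model data `(Φ₁, B₁, Div_{B₁}) → (Φ₂, B₂, Div_{B₂})` over `𝟭 D`** (`Div_B` = second projection on both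
sides, so the compatibility is `η^gp = η^gp`). [cite: MochizukiFrdI2008, Thm. 6.2 (i) p.111] -/
def dataHom : ModelFrobenioid.DataHomOver (𝟭 D) C₁.divBNatTrans C₂.divBNatTrans where
  η := I.η
  β := I.β
  comm A u := (DFunLike.congr_fun (gpMap_eq_monGpMap (I.ηHom A)) u.1.2).symm

/-- **The induced functor `C₁ ⥤ C₂` is an EQUIVALENCE** ([FrdI] Cor. 5.4: over the equivalence `𝟭 D`, along bijective `η`, `β`).
[cite: MochizukiFrdI2008, Cor. 5.4 p.104] -/
theorem functor_isEquivalence : I.dataHom.functor.IsEquivalence :=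
  ModelFrobenioid.DataHomOver.functor_isEquivalence I.dataHom (fun X => I.ηHom_bijective (op X))
    fun X => I.βHom_bijective (op X)

/-- **`Ψ : C₁ ≌ C₂`**, the equivalence of the two tempered Frobenioids induced by the isomorphism of Def. 3.3 (iii) data.
[cite: MochizukiFrdI2008, Cor. 5.4 p.104] -/
def equivalence : C₁.category ≌ C₂.category :=
  haveI := I.functor_isEquivalence
  I.dataHom.functor.asEquivalence

/-- The functor of `Ψ` is the induced functor. [cite: MochizukiFrdI2008, Cor. 5.4 p.104] -/
theorem equivalence_functor : I.equivalence.functor = I.dataHom.functor := rfl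

/-- **`Ψ` lies over `𝟭 D` on the nose**: `Ψ ⋙ Base₂ = Base₁ ⋙ 𝟭`. [cite: MochizukiFrdI2008, Thm. 6.2 (i) p.110] -/
theorem functor_comp_baseFunctor :
    I.equivalence.functor ⋙ C₂.baseFunctorOfCategory = C₁.baseFunctorOfCategory ⋙ 𝟭 D :=
  ModelFrobenioid.DataHomOver.functor_comp_baseFunctor _

/-- **`Ψ` on objects: `(A, α) ↦ (A, η_A^gp α)`.** [cite: MochizukiFrdI2008, Thm. 5.2 (i) p.100] -/
theorem equivalence_functor_obj (A : C₁.category) :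
    I.equivalence.functor.obj A = ⟨A.base, MonGp.map (I.ηHom (op A.base)) A.cls⟩ := rfl

/-- `Ψ` on morphisms: `Base (Ψ φ) = Base φ`. [cite: MochizukiFrdI2008, Thm. 6.2 (i) p.110] -/
theorem baseMap_equivalence_functor_map {A B : C₁.category} (φ : A ⟶ B) :
    ModelFrobenioid.baseMap (I.equivalence.functor.map φ) = ModelFrobenioid.baseMap φ := rfl

/-- `Ψ` on morphisms: `deg_Fr (Ψ φ) = deg_Fr φ`. [cite: MochizukiFrdI2008, Thm. 6.2 (i) p.110] -/
theorem degFr_equivalence_functor_map {A B : C₁.category} (φ : A ⟶ B) :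
    ModelFrobenioid.degFr (I.equivalence.functor.map φ) = ModelFrobenioid.degFr φ := rfl

/-- **`Ψ` on morphisms: `Div (Ψ φ) = η (Div φ)`** (the zero divisor is carried by `e^rlf`). [cite: MochizukiFrdI2008, Thm. 6.2 (i) p.110] -/
theorem div_equivalence_functor_map {A B : C₁.category} (φ : A ⟶ B) :
    ModelFrobenioid.div (I.equivalence.functor.map φ) = I.ηHom (op A.base) (ModelFrobenioid.div φ) := rfl

/-- `Ψ` on morphisms: `u_{Ψ φ} = β (u_φ)`. [cite: MochizukiFrdI2008, Thm. 6.2 (i) p.110] -/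
theorem unit_equivalence_functor_map {A B : C₁.category} (φ : A ⟶ B) :
    ModelFrobenioid.unit (I.equivalence.functor.map φ) = I.βHom (op A.base) (ModelFrobenioid.unit φ) := rfl

end PfIsoData

end TemperedFrobenioid

end Literature.AnabelianGeometry.EtaleTheta

end
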